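import Literature.Analysis.FluidPDE.NSSuitableESS
import Literature.Analysis.FluidPDE.LerayHopfSpatialGradient
import HarnessLib

/-!
# ESS (3.5)–(3.6): an `L_{3,∞}` Leray–Hopf solution is bounded away from the initial time

Analysis/FluidPDE proof file in the decomposition of the endpoint criterion `Literature.Analysis.FluidPDE.ess_endpoint`
(Escauriaza–Seregin–Šverák 2003, Thm. 1.3; see `FluidPDE/NSLerayHopfProofs`,
`FluidPDE/NSSuitableESS`, `FluidPDE/LerayHopfSpatialGradient`). It **discharges the named fact
`NS.ess_sup_bound`** (ESS §3, (3.6): `max_{ℝ³ × [δ, T]} |v| < C₁(δ)`) from the four facts one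
layer closer to the printed local theory:

* `NS.ess_local_holder` — ESS Thm. 1.4 (the local theorem on the unit cylinder);
* `NS.ess_epsilon_regularity` — ESS Lemma 2.2, `k = 1` (ε-regularity of suitable weak solutions);
* `NS.ess_suitable_of_L3infty` — ESS, proof of Thm. 1.4, first paragraph (pairs with
  (1.15)–(1.16) are suitable);
* `NS.ess_associated_pressure` — ESS (3.2)–(3.4) (the associated pressure `p ∈ L_{3/2,∞}`).

## The printed argument (ESS §3, p. 14 of the preprint) and its rendering

"Using known Ladyzhenskaya's arguments […] we can introduce the so-called associated pressure
`p` […] (3.4) `p ∈ L_{3/2,∞}(Q_T)`. Now, let us show that, for any `z₀ ∈ ℝ³ × ]0, T]`, (3.5)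
there is `R > 0` such that `v` is Hölder continuous in `Q̄(z₀, R)`. To this end, take
`R < √t₀` so that `Q(z₀, R) ⊂ Q_T`; making the obvious scaling `ṽ(y, s) = R v(x₀ + Ry, t₀ + R²s)`,
`p̃ = R² p(…)`, the pair `ṽ, p̃` satisfies all conditions of Theorem 1.4, so `ṽ` is Hölder
continuous in `Q̄(1/2)` and `v` in `Q̄(z₀, R/2)`. […] Using scaling arguments, Lemma 2.2 and
statement (3.5), we observe that (3.6) `max_{z ∈ ℝ³ × [δ, T]} |v(z)| < C₁(δ) < +∞`."

Rendering (`NS.ess_sup_bound_of`), for viscosity `ν > 0` and the radius `R = √(νδ/2)` (so that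
every viscous cylinder `Q_ν(z₀, R) = ]t₀ - δ/2, t₀[ × B(x₀, R)` with `t₀ ∈ [δ, T]` lies in
`Q_{δ/2,T}`):

1. the restriction of `(u, p)` to `Q_ν(z₀, R)` satisfies (1.15)–(1.16)
   (`NS.isL3inftyLocalPair_of_strip`: the distributional system restricts, the sliced `L²`/`L³`
   bounds come from the energy class and from `L_{3,∞}`, the space–time weak gradient is the
   jointly measurable one of `Fluid.IsLerayHopfOn.exists_hasWeakSpatialGradientOn`, and
   `∫_Q |p|^{3/2} ≤ ∫∫_{Q_T} (|u|³ + |p|^{3/2}) < ∞` by Tonelli's inequality);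
2. **near field**: by the rescaled Thm. 1.4 (`IsL3inftyLocalPair.exists_ae_bound`) `u` is
   essentially bounded on every `Q_ν(z₀, R/2)`; every point of the compact set
   `[δ, T] × B̄(0, ρ₀)` has an open neighbourhood whose part below `t = T` lies in such a half
   cylinder (`exists_nhds_subset_viscousCylinder`), so finitely many bounds suffice
   (`IsCompact.induction_on`);
3. **far field**: `∫∫_{Q_T} (|u|³ + |p|^{3/2}) < ∞`, so the integral over `{|x| ≥ n}` tends to
   `0` (continuity from above of the measure with this density, `exists_radius_tail_lt`); for
   `|x₀| > ρ₀ = n + R` the cylinder `Q_ν(z₀, R)` lies in that region, the smallness hypothesis of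
   the rescaled Lemma 2.2 (`NS.ess_epsilon_bound_scaled`) holds, and `|u| ≤ c₀ ν / R` a.e. on
   `Q_ν(z₀, R/2)`; countably many such cylinders cover (Lindelöf,
   `TopologicalSpace.countable_cover_nhdsWithin`);
4. the resulting bound a.e. on `]δ, T[ × ℝ³` for the product measure is a bound a.e. in `x` for
   a.e. `t` (`Measure.ae_ae_of_ae_prod`), i.e. `u ∈ L^∞(δ, T; L^∞)`
   (`memLqLp_top_top_of_ae_bound`), which is the accepted rendering of (3.6).

Consequently (`NS.ess_endpoint_of_local_regularity`) the endpoint criterion **ns.S08** follows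
from Thm. 1.4, Lemma 2.2, the suitability paragraph, the associated pressure, Kato's `L³` theory
(Thm. 7.4), weak–strong uniqueness, the energy equality and the Ladyzhenskaya–Prodi–Serrin
theorem (accepted `NS.ess_endpoint_of_sup_bound`).

**Corrected predicate.** Steps 2–4 only use Lemma 2.2 and the suitability paragraph through the
rescaled bound `NS.ess_epsilon_bound_scaled`; `ess_sup_bound_of_scaled` takes that bound as a
hypothesis, `ess_sup_bound_of` feeds it from the accepted (unprimed) facts and
`ess_sup_bound_of'` / `ess_endpoint_of_local_regularity'` from `NS.ess_epsilon_regularity'`,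
`NS.ess_suitable_of_L3infty'` over the corrected rendering `Fluid.IsESSSuitablePairOn` of ESS
Def. 2.1 (`FluidPDE/NSSuitableESS`: the unprimed `Fluid.IsSuitablePairOn` mis-parenthesises (2.4)
and the unprimed `NS.ess_suitable_of_L3infty` is false; the primed one is proved in
`FluidPDE/NSSuitableESSProofs`). **Since the verdict clean-up of 2026-08-16** the unprimed
`ess_suitable_of_L3infty` is `@[deprecated]` (refuted as stated:
`Literature.Analysis.FluidPDE.not_ess_suitable_of_L3infty`, `FluidPDE/NSSuitableESSRefutation`) and
so are its two consumers here, the vacuous implications `ess_sup_bound_of` and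
`ess_endpoint_of_local_regularity` (statements and proofs unchanged; `linter.deprecated` is switched
off for exactly these two declarations, which must name it); use the primed theorems.

## Mathlib search

No Navier–Stokes theory in Mathlib; the measure-theoretic tools used are
`MeasureTheory.lintegral_prod_le` (Tonelli's inequality without measurability),
`MeasureTheory.tendsto_measure_iInter_atTop`, `MeasureTheory.Measure.ae_ae_of_ae_prod`,
`IsCompact.induction_on`, `TopologicalSpace.countable_cover_nhdsWithin`.

## References

* L. Escauriaza, G. Seregin, V. Šverák, *`L_{3,∞}`-solutions of Navier–Stokes equations and
  backward uniqueness*, Uspekhi Mat. Nauk 58:2 (2003) 3–44; Russ. Math. Surveys 58:2 (2003)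
  211–250, §3, (3.2)–(3.6).
* G. Seregin, *Lecture Notes on Regularity Theory for the Navier–Stokes Equations*, World
  Scientific (2014), §6 (ε-regularity, Lemma 6.1) and Thm. 6.21.
-/

noncomputable section

open MeasureTheory TopologicalSpace Set Function Filter Topology Metric Module
open scoped InnerProductSpace RealInnerProductSpace ENNReal NNReal

namespace Literature.Analysis.FluidPDE

/-! ### A pointed cover by half viscous cylinders -/

/-- **Covering lemma for (3.5)–(3.6).** Every space–time point `z = (t, x)` with `t ∈ [δ, T]`
has an open neighbourhood `U` whose part below the final time `T` lies in the inner half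
`Q_ν((t₀, x), R/2)` of a viscous cylinder with top time `t₀ ∈ [δ, T]` (take
`t₀ = min (t + L/2) T`, `L = (R/2)²/ν` the height of the half cylinder, and
`U = {w | t₀ - L < w.1, (w.1 < t₀ ∨ T ≤ t₀), dist w.2 x < R/2}` — when `t₀ = T` the
neighbourhood sticks out beyond `T`, where nothing is claimed). [folklore] -/
theorem exists_nhds_subset_viscousCylinder {X : Type*} [PseudoMetricSpace X] {ν R δ T : ℝ}
    (hν : 0 < ν) (hR : 0 < R) {z : ℝ × X} (hz : z.1 ∈ Icc δ T) :
    ∃ t₀ ∈ Icc δ T, ∃ U : Set (ℝ × X), IsOpen U ∧ z ∈ U ∧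
      ∀ w ∈ U, w.1 < T → w ∈ FluidPDE.viscousCylinder ν (R / 2) (t₀, z.2) := by
  have hLpos : 0 < (R / 2) ^ 2 / ν := by positivity
  set L : ℝ := (R / 2) ^ 2 / ν with hL
  set t₀ : ℝ := min (z.1 + L / 2) T with ht₀
  have ht₀T : t₀ ≤ T := min_le_right _ _
  have ht₀z : t₀ ≤ z.1 + L / 2 := min_le_left _ _
  have hzt₀ : z.1 ≤ t₀ := le_min (by linarith) hz.2
  refine ⟨t₀, ⟨hz.1.trans hzt₀, ht₀T⟩,
    {w | t₀ - L < w.1 ∧ (w.1 < t₀ ∨ T ≤ t₀) ∧ dist w.2 z.2 < R / 2}, ?_, ?_, ?_⟩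
  · refine (isOpen_lt continuous_const continuous_fst).inter (IsOpen.inter ?_ ?_)
    · exact (isOpen_lt continuous_fst continuous_const).union isOpen_const
    · exact isOpen_lt (continuous_snd.dist continuous_const) continuous_const
  · refine ⟨by linarith, ?_, by simpa using half_pos hR⟩
    rcases le_or_gt T (z.1 + L / 2) with h | h
    · exact Or.inr (by rw [ht₀, min_eq_right h])
    · refine Or.inl ?_
      rw [ht₀, min_eq_left h.le]
      linarith
  · rintro w ⟨hw1, hw2, hw3⟩ hwT
    have hwt₀ : w.1 < t₀ := hw2.elim id fun h => lt_of_lt_of_le hwT h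
    simp only [FluidPDE.mem_viscousCylinder]
    exact ⟨⟨hw1, hwt₀⟩, hw3⟩

/-! ### Sliced and space–time Lebesgue bounds -/

/-- `u ∈ L^∞(S; L³)` gives a uniform bound `∫ |u(t)|³ ≤ C` for a.e. `t ∈ S`. [folklore] -/
theorem ae_lintegral_enorm_pow_three_le {X : Type*} [MeasureSpace X] {F : Type*}
    [NormedAddCommGroup F] {u : ℝ → X → F} {S : Set ℝ} (h : FluidPDE.MemLqLp ∞ 3 u S) :
    ∃ C : ℝ≥0, ∀ᵐ t ∂(volume.restrict S), ∫⁻ x, ‖u t x‖ₑ ^ 3 ≤ C := by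
  have hN := h.eLqLpNorm_lt_top
  refine ⟨(FluidPDE.eLqLpNorm ∞ 3 u S ^ 3).toNNReal, ?_⟩
  rw [ENNReal.coe_toNNReal (ENNReal.pow_ne_top hN.ne)]
  filter_upwards [h.ae_eLpNorm_le_top] with t ht
  have e := FluidPDE.eLpNorm_natCast_pow_eq_lintegral volume (u t) (n := 3) (by norm_num)
  rw [Nat.cast_ofNat] at e
  rw [← e]
  gcongr

/-- `p ∈ L^∞(S; L^{3/2})` gives a uniform bound `∫ |p(t)|^{3/2} ≤ C` for a.e. `t ∈ S`. [folklore] -/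
theorem ae_lintegral_enorm_rpow_threeHalves_le {X : Type*} [MeasureSpace X] {F : Type*}
    [NormedAddCommGroup F] {p : ℝ → X → F} {S : Set ℝ} (h : FluidPDE.MemLqLp ∞ (3 / 2) p S) :
    ∃ C : ℝ≥0, ∀ᵐ t ∂(volume.restrict S), ∫⁻ x, ‖p t x‖ₑ ^ (3 / 2 : ℝ) ≤ C := by
  have hN := h.eLqLpNorm_lt_top
  have h0 : (3 / 2 : ℝ≥0∞) ≠ 0 := by simp
  have htop : (3 / 2 : ℝ≥0∞) ≠ ∞ := by simp [ENNReal.div_eq_top]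
  have hq : (3 / 2 : ℝ≥0∞).toReal = 3 / 2 := by simp [ENNReal.toReal_div]
  refine ⟨(FluidPDE.eLqLpNorm ∞ (3 / 2) p S ^ (3 / 2 : ℝ)).toNNReal, ?_⟩
  rw [ENNReal.coe_toNNReal (ENNReal.rpow_ne_top_of_nonneg (by norm_num) hN.ne)]
  filter_upwards [h.ae_eLpNorm_le_top] with t ht
  rw [← hq, lintegral_rpow_enorm_eq_rpow_eLpNorm' (by rw [hq]; norm_num),
    ← eLpNorm_eq_eLpNorm' h0 htop]
  exact ENNReal.rpow_le_rpow ht ENNReal.toReal_nonneg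

/-- The product Lebesgue measure restricted to a strip `S × ℝ³` is the product of the restricted
time measure with the space measure. [folklore] -/
theorem restrict_prod_univ_eq {X : Type*} [MeasureSpace X] [SFinite (volume : Measure X)]
    (S : Set ℝ) :
    ((volume : Measure ℝ).restrict S).prod (volume : Measure X) =
      (volume : Measure (ℝ × X)).restrict (S ×ˢ univ) := by
  rw [Measure.volume_eq_prod, ← Measure.prod_restrict, Measure.restrict_univ]

/-- **Tonelli's inequality on a strip**: if `∫ F(t, ·) ≤ C` for a.e. `t ∈ S` then
`∫∫_{S × ℝ³} F ≤ C |S|`; no measurability of `F` is needed (`lintegral_prod_le`). [folklore] -/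
theorem lintegral_strip_le_of_ae_slice_le {X : Type*} [MeasureSpace X]
    [SFinite (volume : Measure X)] {F : ℝ × X → ℝ≥0∞} {S : Set ℝ} {C : ℝ≥0∞}
    (h : ∀ᵐ t ∂(volume.restrict S), ∫⁻ x, F (t, x) ≤ C) :
    ∫⁻ z in S ×ˢ (univ : Set X), F z ≤ C * volume S := by
  calc ∫⁻ z in S ×ˢ (univ : Set X), F z
      = ∫⁻ z, F z ∂(((volume : Measure ℝ).restrict S).prod (volume : Measure X)) := by
        rw [restrict_prod_univ_eq]
    _ ≤ ∫⁻ t, ∫⁻ x, F (t, x) ∂(volume : Measure X) ∂((volume : Measure ℝ).restrict S) :=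
        lintegral_prod_le _
    _ ≤ ∫⁻ _t, C ∂((volume : Measure ℝ).restrict S) := lintegral_mono_ae h
    _ = C * volume S := by rw [lintegral_const, Measure.restrict_apply_univ]

/-- **Tails of a finite space–time integral**: if `∫∫_S F < ∞` then
`∫∫_{S ∩ {|x| ≥ n}} F < η` for some `n` (continuity from above of the measure `F · (volume|S)`
along the decreasing closed sets `{|x| ≥ n}` with empty intersection). [folklore] -/
theorem exists_radius_tail_lt {X : Type*} [NormedAddCommGroup X] [MeasureSpace X]
    [OpensMeasurableSpace X] {F : ℝ × X → ℝ≥0∞} {S : Set (ℝ × X)}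
    (hF : ∫⁻ z in S, F z < ∞) {η : ℝ≥0∞} (hη : 0 < η) :
    ∃ n : ℕ, ∫⁻ z in S ∩ {z | (n : ℝ) ≤ ‖z.2‖}, F z < η := by
  set μ : Measure (ℝ × X) := (volume.restrict S).withDensity F with hμ
  set s : ℕ → Set (ℝ × X) := fun n => {z | (n : ℝ) ≤ ‖z.2‖} with hs
  have hsm : ∀ n, MeasurableSet (s n) := fun n =>
    (isClosed_le continuous_const (continuous_norm.comp continuous_snd)).measurableSet
  have hanti : Antitone s := fun n m hnm z hz => by
    simp only [hs, mem_setOf_eq] at hz ⊢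
    exact (Nat.cast_le.2 hnm).trans hz
  have hμs : ∀ n, μ (s n) = ∫⁻ z in S ∩ s n, F z := fun n => by
    rw [hμ, withDensity_apply _ (hsm n), Measure.restrict_restrict (hsm n), inter_comm]
  have hfin : ∃ i, μ (s i) ≠ ∞ :=
    ⟨0, by rw [hμs]; exact ((lintegral_mono_set inter_subset_left).trans_lt hF).ne⟩
  have hlim := tendsto_measure_iInter_atTop (μ := μ) (fun n => (hsm n).nullMeasurableSet)
    hanti hfin
  have hempty : (⋂ n, s n) = ∅ := by
    refine Set.subset_eq_empty (fun z hz => ?_) rfl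
    obtain ⟨n, hn⟩ := exists_nat_gt ‖z.2‖
    exact (not_le.2 hn (mem_iInter.1 hz n)).elim
  rw [hempty, measure_empty] at hlim
  obtain ⟨n, hn⟩ := ((tendsto_order.1 hlim).2 η hη).exists
  exact ⟨n, by rw [← hμs]; exact hn⟩

/-- **From a space–time a.e. bound to `L^∞(δ, T; L^∞)`**: a bound `|u| ≤ B` a.e. on
`]δ, T[ × ℝ³` for the product measure is a bound a.e. in `x` for a.e. `t`
(`Measure.ae_ae_of_ae_prod`), whence `u ∈ L^∞(δ, T; L^∞(ℝ³))` in the accepted guarded sense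
(slices a.e. strongly measurable). [folklore] -/
theorem memLqLp_top_top_of_ae_bound {X : Type*} [MeasureSpace X] [SFinite (volume : Measure X)]
    {F : Type*} [NormedAddCommGroup F] {δ T B : ℝ} {u : ℝ → X → F}
    (hmeas : ∀ᵐ t ∂(volume.restrict (Ioo δ T)), AEStronglyMeasurable (u t) volume)
    (hB : ∀ᵐ w ∂(volume : Measure (ℝ × X)), w.1 ∈ Ioo δ T → ‖u w.1 w.2‖ ≤ B) :
    FluidPDE.MemLqLp ∞ ∞ u (Ioo δ T) := by
  have hB' : ∀ᵐ w ∂((volume : Measure ℝ).prod (volume : Measure X)),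
      w.1 ∈ Ioo δ T → ‖u w.1 w.2‖ ≤ B := by
    rw [← Measure.volume_eq_prod]; exact hB
  have h1 := Measure.ae_ae_of_ae_prod hB'
  have h2 : ∀ᵐ t ∂(volume.restrict (Ioo δ T)), ∀ᵐ x ∂(volume : Measure X), ‖u t x‖ ≤ B := by
    rw [ae_restrict_iff' measurableSet_Ioo]
    filter_upwards [h1] with t ht htI
    exact ht.mono fun x hx => hx htI
  refine FluidPDE.memLqLp_of_ae_eLpNorm_le (C := ENNReal.ofReal B) ENNReal.ofReal_ne_top ?_ ?_ ?_
  · rw [Real.volume_Ioo]; exact ENNReal.ofReal_ne_top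
  · filter_upwards [hmeas, h2] with t ht hb
    exact memLp_top_of_bound ht B hb
  · filter_upwards [h2] with t hb
    rw [eLpNorm_exponent_top]
    exact eLpNormEssSup_le_of_ae_bound hb

/-! ### Step 1: the hypotheses of Theorem 1.4 on every admissible cylinder -/

section Local

variable {ν T R t₀ : ℝ} {x₀ : EuclideanSpace ℝ (Fin 3)}
  {u : ℝ → EuclideanSpace ℝ (Fin 3) → EuclideanSpace ℝ (Fin 3)}
  {p : ℝ → EuclideanSpace ℝ (Fin 3) → ℝ}
  {G : ℝ → EuclideanSpace ℝ (Fin 3) → EuclideanSpace ℝ (Fin 3) →L[ℝ] EuclideanSpace ℝ (Fin 3)}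
  {C₂ C₃ : ℝ≥0}

/-- **ESS §3, "take `R < √t₀` so that `Q(z₀, R) ⊂ Q_T` […] the pair `ṽ, p̃` satisfies all
conditions of Theorem 1.4"**: if `(u, p)` solves the system in the sense of distributions on the
strip `Q_T`, `u ∈ L_{2,∞} ∩ L_{3,∞}(Q_T)` slice-wise, `u` has a square-integrable space–time weak
gradient on the strip, and `∫∫_{Q_T} (|u|³ + |p|^{3/2}) < ∞`, then on every viscous cylinder
`Q_ν(z₀, R) ⊂ Q_T` (`R²/ν ≤ t₀ ≤ T`) the pair satisfies the hypotheses (1.15)–(1.16) of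
Thm. 1.4 (`NS.IsL3inftyLocalPair`). Real proof (restriction). [cite: EscauriazaSereginSverak2003, §3, proof of (3.5)] -/
theorem isL3inftyLocalPair_of_strip (ht₀ : R ^ 2 / ν ≤ t₀) (ht₀T : t₀ ≤ T)
    (hdist : FluidPDE.IsDistributionalNSSolutionOn
      (FluidPDE.slab (EuclideanSpace ℝ (Fin 3)) (Ioo 0 T) isOpen_Ioo) ν 0 u p)
    (h₂ : ∀ᵐ t ∂(volume.restrict (Ioo 0 T)), ∫⁻ x, ‖u t x‖ₑ ^ 2 ≤ C₂)
    (h₃ : ∀ᵐ t ∂(volume.restrict (Ioo 0 T)), ∫⁻ x, ‖u t x‖ₑ ^ 3 ≤ C₃)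
    (hG : FluidPDE.HasWeakSpatialGradientOn
      (FluidPDE.slab (EuclideanSpace ℝ (Fin 3)) (Ioo 0 T) isOpen_Ioo) u G)
    (hGint : ∫⁻ z in Ioo 0 T ×ˢ (univ : Set (EuclideanSpace ℝ (Fin 3))),
      ENNReal.ofReal (FluidPDE.frobeniusNormSq (G z.1 z.2)) < ∞)
    (hF : ∫⁻ z in Ioo 0 T ×ˢ (univ : Set (EuclideanSpace ℝ (Fin 3))),
      (‖u z.1 z.2‖ₑ ^ 3 + ‖p z.1 z.2‖ₑ ^ (3 / 2 : ℝ)) < ∞) :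
    IsL3inftyLocalPair ν R (t₀, x₀) u p := by
  have hI : Ioo (t₀ - R ^ 2 / ν) t₀ ⊆ Ioo 0 T := Ioo_subset_Ioo (by linarith) ht₀T
  have hQS :
      FluidPDE.viscousCylinder ν R (t₀, x₀) ⊆ Ioo 0 T ×ˢ (univ : Set (EuclideanSpace ℝ (Fin 3))) :=
    (FluidPDE.viscousCylinder_subset_prod_univ ν R (t₀, x₀)).trans (prod_mono hI Subset.rfl)
  have hQle : FluidPDE.viscousCylinderOpens ν R (t₀, x₀) ≤
      FluidPDE.slab (EuclideanSpace ℝ (Fin 3)) (Ioo 0 T) isOpen_Ioo := by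
    intro z hz
    exact FluidPDE.mem_slab.2 (hQS hz).1
  refine ⟨hdist.of_le hQle, ⟨C₂, ?_⟩, ⟨G, hG.mono hQle, ?_⟩, ?_, ⟨C₃, ?_⟩⟩
  · exact (ae_restrict_of_ae_restrict_of_subset hI h₂).mono fun t ht =>
      (setLIntegral_le_lintegral _ _).trans ht
  · exact (lintegral_mono_set hQS).trans_lt hGint
  · exact (lintegral_mono_set hQS).trans_lt ((lintegral_mono fun z => le_add_self).trans_lt hF)
  · exact (ae_restrict_of_ae_restrict_of_subset hI h₃).mono fun t ht =>
      (setLIntegral_le_lintegral _ _).trans ht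

end Local

/-! ### Steps 2–4: `NS.ess_sup_bound` from the local theory -/

/-- **ESS (3.6) from Theorem 1.4, the rescaled Lemma 2.2 and the associated pressure**
(Escauriaza–Seregin–Šverák 2003, §3, proof of Thm. 1.3, (3.5)–(3.6)): the core of
`ess_sup_bound_of`, with the rescaled ε-regularity bound (the common statement of
`ess_epsilon_bound_scaled` and `ess_epsilon_bound_scaled'`: `(νR)⁻² ∫_{Q_ν(z₀,R)} (|u|³ + |p|^{3/2})
< ε₀ ⇒ |u| ≤ c₀ ν / R` a.e. on `Q_ν(z₀, R/2)`) taken as a hypothesis, so that both the accepted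
and the corrected renderings of ESS Def. 2.1 feed it (near field: rescaled Thm. 1.4 on the
cylinders `Q_ν(z₀, √(νδ/2))`, `t₀ ∈ [δ, T]`, and compactness of `[δ, T] × B̄(0, ρ₀)`; far field:
the tails of `∫∫_{Q_T} (|u|³ + |p|^{3/2})`; see the module docstring). Real proof. [cite: EscauriazaSereginSverak2003, §3 (3.5)–(3.6)] -/
theorem ess_sup_bound_of_scaled (hLH : ess_local_holder)
    (hsc : ∃ ε₀ c₀ : ℝ, 0 < ε₀ ∧ 0 < c₀ ∧ ∀ {ν R t₀ : ℝ} {x₀ : EuclideanSpace ℝ (Fin 3)}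
      {u : ℝ → EuclideanSpace ℝ (Fin 3) → EuclideanSpace ℝ (Fin 3)}
      {p : ℝ → EuclideanSpace ℝ (Fin 3) → ℝ},
      0 < ν → 0 < R → IsL3inftyLocalPair ν R (t₀, x₀) u p →
      ENNReal.ofReal ((ν ^ 2 * R ^ 2)⁻¹) *
          ∫⁻ z in FluidPDE.viscousCylinder ν R (t₀, x₀),
            (‖u z.1 z.2‖ₑ ^ 3 + ‖p z.1 z.2‖ₑ ^ (3 / 2 : ℝ)) < ENNReal.ofReal ε₀ →
      ∀ᵐ z ∂(volume.restrict (FluidPDE.viscousCylinder ν (R / 2) (t₀, x₀))),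
        ‖u z.1 z.2‖ ≤ c₀ * ν / R)
    (hP : ess_associated_pressure) : ess_sup_bound := by
  intro ν T hν hT u₀ u hu₀ hdiv hu h₃ δ hδ
  -- the associated pressure (3.2)–(3.4) and the distributional system on the strip
  obtain ⟨p, hp, hdist⟩ := hP hν hT hu₀ hdiv hu h₃
  -- the jointly measurable square-integrable weak spatial gradient on the strip
  obtain ⟨G, hG, -, hGint, -⟩ := hu.exists_hasWeakSpatialGradientOn
  -- sliced bounds: energy class, `L_{3,∞}`, `L_{3/2,∞}`
  obtain ⟨C₂, hC₂⟩ := hu.energy_bound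
  have hC₂' : ∀ᵐ t ∂(volume.restrict (Ioo 0 T)), ∫⁻ x, ‖u t x‖ₑ ^ 2 ≤ C₂ :=
    hC₂.mono fun t ht => by simpa only [FluidPDE.eEnergy] using ht
  obtain ⟨C₃, hC₃⟩ := ae_lintegral_enorm_pow_three_le h₃
  obtain ⟨Cp, hCp⟩ := ae_lintegral_enorm_rpow_threeHalves_le hp
  -- the smallness density of Lemma 2.2 is integrable over the strip
  set F : ℝ × EuclideanSpace ℝ (Fin 3) → ℝ≥0∞ := fun z =>
    ‖u z.1 z.2‖ₑ ^ 3 + ‖p z.1 z.2‖ₑ ^ (3 / 2 : ℝ) with hFdef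
  have hF : ∫⁻ z in Ioo 0 T ×ˢ (univ : Set (EuclideanSpace ℝ (Fin 3))), F z < ∞ := by
    have hslice : ∀ᵐ t ∂(volume.restrict (Ioo 0 T)),
        ∫⁻ x, F (t, x) ≤ (C₃ : ℝ≥0∞) + Cp := by
      filter_upwards [hC₃, hCp, h₃.1] with t h3 hp' hm
      have hfm : AEMeasurable (fun x => ‖u t x‖ₑ ^ 3) volume := hm.1.enorm.pow_const 3
      calc ∫⁻ x, F (t, x) = ∫⁻ x, ‖u t x‖ₑ ^ 3 + ‖p t x‖ₑ ^ (3 / 2 : ℝ) := rfl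
        _ = (∫⁻ x, ‖u t x‖ₑ ^ 3) + ∫⁻ x, ‖p t x‖ₑ ^ (3 / 2 : ℝ) := lintegral_add_left' hfm _
        _ ≤ C₃ + Cp := add_le_add h3 hp'
    refine (lintegral_strip_le_of_ae_slice_le hslice).trans_lt ?_
    refine ENNReal.mul_lt_top (ENNReal.add_lt_top.2 ⟨ENNReal.coe_lt_top, ENNReal.coe_lt_top⟩) ?_
    rw [Real.volume_Ioo]
    exact ENNReal.ofReal_lt_top
  -- the radius: `R² / ν = δ / 2`
  set R : ℝ := Real.sqrt (ν * δ / 2) with hRdef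
  have hνδ : 0 < ν * δ / 2 := by have := hδ.1; positivity
  have hR : 0 < R := Real.sqrt_pos.2 hνδ
  have hR2 : R ^ 2 / ν = δ / 2 := by
    rw [hRdef, Real.sq_sqrt hνδ.le]
    field_simp
  -- Step 1: the hypotheses of Thm. 1.4 on every cylinder `Q_ν(z₀, R)`, `t₀ ∈ [δ, T]`
  have hloc : ∀ t₀ ∈ Icc δ T, ∀ x₀ : EuclideanSpace ℝ (Fin 3),
      IsL3inftyLocalPair ν R (t₀, x₀) u p :=
    fun t₀ ht₀ x₀ => isL3inftyLocalPair_of_strip (by rw [hR2]; linarith [ht₀.1, hδ.1]) ht₀.2 hdist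
      hC₂' hC₃ hG hGint hF
  -- Step 2 (near field): Thm. 1.4 rescaled gives an a.e. bound on every half cylinder
  have near : ∀ t₀ ∈ Icc δ T, ∀ x₀ : EuclideanSpace ℝ (Fin 3), ∃ M : ℝ,
      ∀ᵐ z ∂(volume.restrict (FluidPDE.viscousCylinder ν (R / 2) (t₀, x₀))), ‖u z.1 z.2‖ ≤ M :=
    fun t₀ ht₀ x₀ => (hloc t₀ ht₀ x₀).exists_ae_bound hLH hν hR
  -- Step 3 (far field): Lemma 2.2 rescaled, with the smallness supplied by the tails of `F`
  obtain ⟨ε₀, c₀, hε₀, hc₀, Hfar⟩ := hsc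
  have hη : 0 < ENNReal.ofReal (ν ^ 2 * R ^ 2 * ε₀) := ENNReal.ofReal_pos.2 (by positivity)
  obtain ⟨n, hn⟩ := exists_radius_tail_lt hF hη
  have far : ∀ t₀ ∈ Icc δ T, ∀ x₀ : EuclideanSpace ℝ (Fin 3), (n : ℝ) + R < ‖x₀‖ →
      ∀ᵐ z ∂(volume.restrict (FluidPDE.viscousCylinder ν (R / 2) (t₀, x₀))),
        ‖u z.1 z.2‖ ≤ c₀ * ν / R := by
    intro t₀ ht₀ x₀ hx₀
    refine Hfar hν hR (hloc t₀ ht₀ x₀) ?_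
    have hsub : FluidPDE.viscousCylinder ν R (t₀, x₀) ⊆
        (Ioo 0 T ×ˢ (univ : Set (EuclideanSpace ℝ (Fin 3)))) ∩ {z | (n : ℝ) ≤ ‖z.2‖} := by
      intro z hz
      simp only [FluidPDE.mem_viscousCylinder] at hz
      obtain ⟨⟨hz1, hz2⟩, hz3⟩ := hz
      refine ⟨⟨⟨?_, hz2.trans_le ht₀.2⟩, mem_univ _⟩, ?_⟩
      · rw [hR2] at hz1
        linarith [ht₀.1, hδ.1]
      · show (n : ℝ) ≤ ‖z.2‖
        have h1 := norm_sub_norm_le x₀ z.2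
        rw [← dist_eq_norm, dist_comm] at h1
        linarith
    have h1 : ∫⁻ z in FluidPDE.viscousCylinder ν R (t₀, x₀), F z <
        ENNReal.ofReal (ν ^ 2 * R ^ 2 * ε₀) := (lintegral_mono_set hsub).trans_lt hn
    have ha : ENNReal.ofReal ((ν ^ 2 * R ^ 2)⁻¹) ≠ 0 :=
      (ENNReal.ofReal_pos.2 (by positivity)).ne'
    have h2 := ENNReal.mul_lt_mul_right ha ENNReal.ofReal_ne_top h1
    refine lt_of_lt_of_eq h2 ?_
    rw [← ENNReal.ofReal_mul (by positivity)]
    congr 1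
    field_simp
  -- Step 2 concluded: finitely many cylinders over the compact `[δ, T] × B̄(0, n + R)`
  set K : Set (ℝ × EuclideanSpace ℝ (Fin 3)) :=
    Icc δ T ×ˢ closedBall (0 : EuclideanSpace ℝ (Fin 3)) ((n : ℝ) + R) with hKdef
  have hK : IsCompact K := isCompact_Icc.prod (isCompact_closedBall _ _)
  have hnear : ∃ M : ℝ, ∀ᵐ w ∂(volume : Measure (ℝ × EuclideanSpace ℝ (Fin 3))),
      w ∈ K → w.1 < T → ‖u w.1 w.2‖ ≤ M := by
    refine hK.induction_on
      (p := fun A => ∃ M : ℝ, ∀ᵐ w ∂(volume : Measure (ℝ × EuclideanSpace ℝ (Fin 3))),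
        w ∈ A → w.1 < T → ‖u w.1 w.2‖ ≤ M) ?_ ?_ ?_ ?_
    · exact ⟨0, Eventually.of_forall fun w hw => hw.elim⟩
    · rintro A B hAB ⟨M, hM⟩
      exact ⟨M, hM.mono fun w hw hwA => hw (hAB hwA)⟩
    · rintro A B ⟨M, hM⟩ ⟨M', hM'⟩
      refine ⟨max M M', ?_⟩
      filter_upwards [hM, hM'] with w hw hw'
      rintro (hA | hB) hwT
      · exact (hw hA hwT).trans (le_max_left _ _)
      · exact (hw' hB hwT).trans (le_max_right _ _)
    · rintro z ⟨hz1, -⟩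
      obtain ⟨t₀, ht₀, U, hUo, hzU, hU⟩ :=
        exists_nhds_subset_viscousCylinder (δ := δ) (T := T) hν hR hz1
      obtain ⟨M, hM⟩ := near t₀ ht₀ z.2
      refine ⟨U, mem_nhdsWithin_of_mem_nhds (hUo.mem_nhds hzU), M, ?_⟩
      rw [ae_restrict_iff' (FluidPDE.measurableSet_viscousCylinder _ _ _)] at hM
      filter_upwards [hM] with w hw hwU hwT
      exact hw (hU w hwU hwT)
  obtain ⟨M₁, hM₁⟩ := hnear
  -- Step 3 concluded: countably many cylinders over the far region (Lindelöf)
  set FR : Set (ℝ × EuclideanSpace ℝ (Fin 3)) :=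
    {z | z.1 ∈ Icc δ T ∧ (n : ℝ) + R < ‖z.2‖} with hFRdef
  have hfar : ∀ᵐ w ∂(volume : Measure (ℝ × EuclideanSpace ℝ (Fin 3))),
      w ∈ FR → w.1 < T → ‖u w.1 w.2‖ ≤ c₀ * ν / R := by
    choose! t₀ ht₀ U hUo hzU hU using
      fun (z : ℝ × EuclideanSpace ℝ (Fin 3)) (hz : z ∈ FR) =>
      exists_nhds_subset_viscousCylinder (ν := ν) (R := R) (δ := δ) (T := T) hν hR hz.1
    obtain ⟨t, htFR, htc, hcover⟩ := TopologicalSpace.countable_cover_nhdsWithin (f := U)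
      (s := FR) fun z hz => mem_nhdsWithin_of_mem_nhds ((hUo z hz).mem_nhds (hzU z hz))
    have hall : ∀ᵐ w ∂(volume : Measure (ℝ × EuclideanSpace ℝ (Fin 3))), ∀ z ∈ t,
        w ∈ U z → w.1 < T → ‖u w.1 w.2‖ ≤ c₀ * ν / R := by
      refine (eventually_countable_ball htc).2 fun z hz => ?_
      have hzFR : z ∈ FR := htFR hz
      have h1 := far (t₀ z) (ht₀ z hzFR) z.2 hzFR.2
      rw [ae_restrict_iff' (FluidPDE.measurableSet_viscousCylinder _ _ _)] at h1
      filter_upwards [h1] with w hw hwU hwT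
      exact hw (hU z hzFR w hwU hwT)
    filter_upwards [hall] with w hw hwFR hwT
    obtain ⟨z, hz, hwz⟩ := mem_iUnion₂.1 (hcover hwFR)
    exact hw z hz hwz hwT
  -- Step 4: the bound a.e. on `]δ, T[ × ℝ³`, hence `u ∈ L^∞(δ, T; L^∞)`
  have hB : ∀ᵐ w ∂(volume : Measure (ℝ × EuclideanSpace ℝ (Fin 3))),
      w.1 ∈ Ioo δ T → ‖u w.1 w.2‖ ≤ max M₁ (c₀ * ν / R) := by
    filter_upwards [hM₁, hfar] with w hw1 hw2 hwI
    by_cases hx : ‖w.2‖ ≤ (n : ℝ) + R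
    · exact (hw1 ⟨Ioo_subset_Icc_self hwI, mem_closedBall_zero_iff.2 hx⟩ hwI.2).trans
        (le_max_left _ _)
    · exact (hw2 ⟨Ioo_subset_Icc_self hwI, not_le.1 hx⟩ hwI.2).trans (le_max_right _ _)
  have hmeas : ∀ᵐ t ∂(volume.restrict (Ioo δ T)), AEStronglyMeasurable (u t) volume :=
    (ae_restrict_of_ae_restrict_of_subset (Ioo_subset_Ioo hδ.1.le le_rfl) h₃.1).mono
      fun t ht => ht.1
  exact memLqLp_top_top_of_ae_bound hmeas hB

-- `linter.deprecated` is switched off for the next declaration only: its hypothesis `hS` is the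
-- refuted `ess_suitable_of_L3infty`, deprecated (2026-08-16, p92741) in `NSSuitableESS.lean` with
-- `ess_epsilon_bound_scaled`; the implication is kept verbatim and deprecated itself. REMOVE-WHEN
-- that `def` is deleted.
set_option linter.deprecated false in
/-- **Deprecated (2026-08-16): a vacuous implication — its hypothesis `hS : ess_suitable_of_L3infty`
is refuted as stated (`Literature.Analysis.FluidPDE.not_ess_suitable_of_L3infty`); use
`ess_sup_bound_of'` below.** Statement and proof unchanged. Original description:
**ESS (3.6) from Theorem 1.4, Lemma 2.2, the suitability of `L_{3,∞}` pairs and the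
associated pressure** (Escauriaza–Seregin–Šverák 2003, §3, proof of Thm. 1.3, (3.5)–(3.6):
"Using scaling arguments, Lemma 2.2 and statement (3.5), we observe that
`max_{z ∈ ℝ³ × [δ, T]} |v(z)| < C₁(δ) < +∞`"). Real proof of the named fact `NS.ess_sup_bound`
from the named facts `NS.ess_local_holder`, `NS.ess_epsilon_regularity`,
`NS.ess_suitable_of_L3infty`, `NS.ess_associated_pressure` (near field: rescaled Thm. 1.4 on the
cylinders `Q_ν(z₀, √(νδ/2))`, `t₀ ∈ [δ, T]`, and compactness of `[δ, T] × B̄(0, ρ₀)`; far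
field: the tails of `∫∫_{Q_T} (|u|³ + |p|^{3/2})` and the rescaled Lemma 2.2; see the module
docstring). [cite: EscauriazaSereginSverak2003, §3 (3.5)–(3.6)] -/
@[deprecated "vacuous: the hypothesis ess_suitable_of_L3infty is refuted as stated \
  (not_ess_suitable_of_L3infty, NSSuitableESSRefutation.lean); use ess_sup_bound_of'"
  (since := "2026-08-16")]
theorem ess_sup_bound_of (hLH : ess_local_holder) (hε : ess_epsilon_regularity)
    (hS : ess_suitable_of_L3infty) (hP : ess_associated_pressure) : ess_sup_bound :=
  ess_sup_bound_of_scaled hLH (ess_epsilon_bound_scaled hε hS) hP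

/-- **ESS (3.6) over the corrected rendering of Def. 2.1** (Escauriaza–Seregin–Šverák 2003, §3,
(3.5)–(3.6)): `NS.ess_sup_bound` from `NS.ess_local_holder`, `NS.ess_epsilon_regularity'`,
`NS.ess_suitable_of_L3infty'` (Lemma 2.2 and the first paragraph of the proof of Thm. 1.4 over
`Fluid.IsESSSuitablePairOn`, the parenthesised (2.4); the unprimed `NS.ess_suitable_of_L3infty`
over `Fluid.IsSuitablePairOn` is false, see `FluidPDE/NSSuitableESS`) and
`NS.ess_associated_pressure`, through `ess_epsilon_bound_scaled'`. Real proof. [cite: EscauriazaSereginSverak2003, §3 (3.5)–(3.6)] -/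
theorem ess_sup_bound_of' (hLH : ess_local_holder) (hε : ess_epsilon_regularity')
    (hS : ess_suitable_of_L3infty') (hP : ess_associated_pressure) : ess_sup_bound :=
  ess_sup_bound_of_scaled hLH (ess_epsilon_bound_scaled' hε hS) hP

-- `linter.deprecated` is switched off for the next declaration only (hypothesis `hS` and the
-- deprecated `ess_sup_bound_of` in its proof); kept verbatim, deprecated itself. REMOVE-WHEN the
-- `def` `ess_suitable_of_L3infty` (deprecated 2026-08-16, p92741) is deleted.
set_option linter.deprecated false in
/-- **Deprecated (2026-08-16): a vacuous implication — its hypothesis `hS : ess_suitable_of_L3infty`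
is refuted as stated (`Literature.Analysis.FluidPDE.not_ess_suitable_of_L3infty`); use
`ess_endpoint_of_local_regularity'` below.** Statement and proof unchanged. Original description:
**`NS.ess_endpoint` from the local regularity theory** (ESS 2003, Thm. 1.3 with §3): the
endpoint criterion **ns.S08** follows from ESS Thm. 1.4 (`ess_local_holder`), Lemma 2.2
(`ess_epsilon_regularity`), the suitability of `L_{3,∞}` pairs (`ess_suitable_of_L3infty`), the
associated pressure (`ess_associated_pressure`), Kato's `L³` theory (Thm. 7.4,
`ess_kato_L3_local`), weak–strong uniqueness (**ns.S07**), the energy equality for `L⁴(Q_T)`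
solutions (`galdi_energy_equality`) and the Ladyzhenskaya–Prodi–Serrin theorem (**ns.S06**):
`ess_sup_bound_of` followed by the accepted `ess_endpoint_of_sup_bound`. Real proof. [cite: EscauriazaSereginSverak2003, Thm. 1.3] -/
@[deprecated "vacuous: the hypothesis ess_suitable_of_L3infty is refuted as stated \
  (not_ess_suitable_of_L3infty, NSSuitableESSRefutation.lean); \
  use ess_endpoint_of_local_regularity'" (since := "2026-08-16")]
theorem ess_endpoint_of_local_regularity (hLH : ess_local_holder) (hε : ess_epsilon_regularity)
    (hS : ess_suitable_of_L3infty) (hP : ess_associated_pressure) (hK : ess_kato_L3_local)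
    (hWS : weak_strong_uniqueness) (hG : galdi_energy_equality)
    (hLPS : ladyzhenskaya_prodi_serrin) : ess_endpoint :=
  ess_endpoint_of_sup_bound (ess_sup_bound_of hLH hε hS hP) hK hWS hG hLPS

/-- **`NS.ess_endpoint` from the local regularity theory, corrected predicate** (ESS 2003,
Thm. 1.3 with §3): as `ess_endpoint_of_local_regularity`, with Lemma 2.2 and the suitability of
`L_{3,∞}` pairs taken over the corrected rendering `Fluid.IsESSSuitablePairOn` of Def. 2.1
(`ess_epsilon_regularity'`, `ess_suitable_of_L3infty'` — the latter is proved in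
`FluidPDE/NSSuitableESSProofs`). Real proof. [cite: EscauriazaSereginSverak2003, Thm. 1.3] -/
theorem ess_endpoint_of_local_regularity' (hLH : ess_local_holder)
    (hε : ess_epsilon_regularity') (hS : ess_suitable_of_L3infty') (hP : ess_associated_pressure)
    (hK : ess_kato_L3_local) (hWS : weak_strong_uniqueness) (hG : galdi_energy_equality)
    (hLPS : ladyzhenskaya_prodi_serrin) : ess_endpoint :=
  ess_endpoint_of_sup_bound (ess_sup_bound_of' hLH hε hS hP) hK hWS hG hLPS

end Literature.Analysis.FluidPDE
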